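import Literature.NumberTheory.Automorphic.ReciprocityGLn
import Literature.NumberTheory.GaloisRepresentations.SymplecticMultiplier
import HarnessLib

/-!
# Ordinary higher Hida theory of the Siegel threefold: the interface (carrier)

Topic `Literature/NumberTheory/Automorphic` (definition item `defn-OrdinaryHigherHidaGSp4`, wanted by
route `Langlands/RepeatedRootSocle`, crux `LimitClassicalUnrefined` (stmt-Langlands-18087), to TYPE
its informal children `FibreCyclicity` and `SocleCousinVanishing`).

Let `p` be a prime and `K^p ⊂ GSp₄(𝔸^{p,∞})` a neat tame level with bad places `S ∌ p`.
Boxer–Pilloni construct, for each of the four Kostant representatives `w ∈ W^M`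
(`ℓ(w) = 0, 1, 2, 3`), perfect complexes of `ℤ_p[[T(ℤ_p)]]`-modules (`T` the diagonal torus of
`GSp₄`) whose cohomology in degree `ℓ(w)`, `M_w`, is a finite projective `𝒪[[T(ℤ_p)]]`-module with
an action of `T(ℚ_p)` and of the prime-to-`p` Hecke algebra `𝕋^p`, specialising at dominant
algebraic characters to the ordinary coherent cohomology `H^{ℓ(w)}(Sh^tor_{Iw(p)K^p}, ω^κ)^ord` of
automorphic vector bundles on the Siegel threefold, at every algebraic character with `M`-dominant
`κ` to the `T(ℤ_p)`-fixed ordinary higher Coleman cohomology `H^{ℓ(w)}_w(Sh^tor_{K^p}, ω^{κ,sm})^{ord}`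
(comparison of higher Hida and higher Coleman theory), and in perfect duality
`M_w × M_{w₀ᴹ w w₀} → 𝒪[[T(ℤ_p)]]`. [cite: BoxerCalegariGeePilloni2025, §7.3 Thm. 7.3.1 (= Thm. 347) (1)–(4), Rem. 7.3.3–7.3.4 (= Rem. 349–350)]
[cite: BoxerPilloni2025, Introduction]  At the singular weight `λ = (1,1;w)` (weight-`(2,2)`
forms) Boxer–Calegari–Gee–Pilloni prove: the ordinary part of `RΓ(Sh^tor_{K^p}, ω^{(1,1;−w),sm})`
is computed by the two-term complex `[H²_{²w}(…)^ord —Cous→ H³_{³w}(…)^ord]` in degrees `[2,3]`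
whose differential is the COUSIN map, and Serre-dually `RΓ(Sh^tor_{K^p}, ω^{(2,2;−w),sm}(−D))^ord`
by `[H⁰_{⁰w} —Cous→ H¹_{¹w}]` in degrees `[0,1]` (ordinary `p`-adic and higher `p`-adic modular
forms of weight `2`) [cite: BoxerCalegariGeePilloni2025, §4.10 Prop. 4.10.1–4.10.2 and Rem. 4.10.3 (= Prop. 268–269, Rem. 270); §1.3];
the ordinary part `V = H³(RHom_𝔟(λ, RΓ(Sh^tor_{K^p}, ℚ̄_p)^la)^ord_𝔪)` of the `𝔟`-cohomology of
the locally analytic completed cohomology, localised at an irreducible `ρ̄`, is concentrated in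
degree `3`, and `V_{ℂ_p} = V ⊗ ℂ_p` carries a `G_{ℚ_p} × 𝕋_{K^p} × T(ℚ_p)`-equivariant decreasing
filtration `Fil^i`, `i = 0,…,3`, with `Gr^i V_{ℂ_p}` the ordinary higher Coleman cohomology in
degree `i` (`p`-adic Eichler–Shimura) on which the SEN operator is scalar, acting by `−2−w/2` on
`Gr⁰, Gr¹` and by `−1−w/2` on `Gr², Gr³` [cite: BoxerCalegariGeePilloni2025, §4.9 Thm. 4.9.7 (= Thm. 267) and §4.10.3];
the nilpotent `Θ + 1 + w/2` on the generalised eigenspace `V_{ℂ_p}[(Θ+1+w/2)²]` (an extension of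
`Gr²` by `Gr³`) induces the SEN MAP `H² → H³`, and the Cousin and Sen maps `H² → H³` agree up to a
non-zero scalar [cite: BoxerCalegariGeePilloni2025, §4.10.4 Thm. 4.10.4 (= Thm. 271)]; whence the
classicality theorem: an ordinary overconvergent weight-`2` eigenform `f` with big-image, de Rham
`ρ_f`, multiplicity condition (3) and irreducible `ρ̄_f` is classical, the kernel of the Sen = Cousin
map on `H²[𝔪_f]` being the classical forms and the map vanishing because `V_{ℂ_p}[𝔪_f] = D_Sen(ρ_f)^{⊕n}`
has semisimple Sen operator [cite: BoxerCalegariGeePilloni2025, §4.12 Thm. 4.12.4 (= Thm. 277), Rem. 4.12.5–4.12.6 (= Rem. 278–279), Lemma 4.12.3 (= Lemma 276)].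

LOCATORS. `arXiv:2502.20645`: section numbers, plus environment numbers in the per-subsection
dotted form of the PDF (`Thm. 4.12.4`), computed from — and given alongside — the sequential
numbering of the held TeX text (`Thm. 277`); e.g. `§7.5: Prop. 370 = Prop. 7.5.3, Thm. 375 =
Thm. 7.5.8` agrees with the locators used elsewhere in the tree.  `arXiv:1812.09269`
[BoxerEtAl2021]: dotted numbers of Publ. IHÉS (`Thm. 2.7.1 = Thm. 40`, `Lemma 2.9.1 = Lemma 48`,
`Thm. 2.9.3 = Thm. 50`, `Prop. 7.4.8` of the 2025 paper `= Prop. 362`).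

Neither integral toroidal compactifications of Siegel threefolds, nor coherent cohomology of
automorphic bundles, ordinary projectors, locally analytic completed cohomology or Sen theory exist
in Mathlib or in this tree, so — exactly as for the accepted `Eigenvariety` interface
(`Literature/NumberTheory/Automorphic/Eigenvariety.lean`) and as the item demands ("existence /
perfectness are BCGP theorems to be recorded as named facts, never smuggled into the carrier") —
this file fixes the TYPE OF THE DATUM that ordinary higher Hida theory of `GSp₄/ℚ` hands to the
socle argument, and the PROPERTIES Boxer–Pilloni / BCGP prove for their construction, as separate
predicates.  No theorem and no existence statement is a field; "there is such a datum with
properties …" is a statement ABOUT this type, to be made by the route (and, once, as a named fact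
of the literature in a separate `--kind definition` proposal citing BCGP — deliberately not here:
over an interface a bare existence claim is inhabited by the zero datum `trivial`, cf.
`Eigenvariety`, "What is deliberately NOT here").

## Contents

* `gsp4FrobPoly q t = X⁴ − t₁X³ + (q t₂ + (q³+q) t₀)X² − q³ t₀t₁ X + q⁶ t₀²` — the spherical Hecke
  polynomial `Q_v(X)` of `GSp₄` in the eigenvalues `t_i` of `T_{v,i} = [GSp₄(𝒪_v) β_{v,i} GSp₄(𝒪_v)]`
  (`β_{v,0} = ϖ·1₄`, `β_{v,1} = diag(ϖ,ϖ,1,1)`, `β_{v,2} = diag(ϖ²,ϖ,ϖ,1)`), the characteristic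
  polynomial of `rec_{GT,p}(π_v ⊗ |ν|^{-3/2})(Frob_v)` for unramified `π_v`
  [cite: BoxerEtAl2021, §2.4.3 and §7.9 (the polynomial `Q_v(X) ∈ 𝕋[X]`)], with `gsp4FrobPoly_map`,
  `monic_gsp4FrobPoly`, `natDegree_gsp4FrobPoly`; and
  `FramedGaloisRep.IsGSp4HeckeAssociatedAt ρ v t` — `ρ` unramified at `v` with
  `det(X − ρ(Frob_v)) = Q_v(t)` for GEOMETRIC Frobenii (BCGP's convention [cite: BoxerEtAl2021, §2.1]),
  rendered on the tree's arithmetic Frobenii `σ` as `charpoly ρ(σ⁻¹)` (same device as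
  `FramedGaloisRep.IsHeckeAssociatedAt` of `Eigenvariety`).
* `OrdinaryHigherHidaGSp4 p S Λ 𝕋` — THE DATUM (see its docstring), over a coefficient ring `Λ`
  (intended `𝒪[[T(ℤ_p)]]`) GIVEN WITH its weight-`(2,2)` specialisation as the structure map
  `[Algebra Λ ℚ̄_p]`, and a commutative `Λ`-algebra `𝕋` of Hecke operators.
* Derived vocabulary (the predicates the item asks for): `IsWeightTwoPoint`, `IsPointAt 𝔪 x` ("`x`
  is a characteristic-zero point of `𝕋` localised at `𝔪`"), the fibres `fibreAt i x`
  (`x`-generalised eigenspace of `H i` = "the weight-`(2,2)` fibre of `M^{(i)}` at `x`" through the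
  comparison), `eigenspaceAt`, `hidaFibreAt`, `IsCyclicAt`; on the `𝔟`-cohomology `VC = V_{ℂ_p}`,
  `heckeVC`, the torsion `torsionAt x = V_{ℂ_p}[𝔪_x]`, `genEigenspaceV`, `maximalIdealImage x =
  𝔪_x V_{ℂ_p}` and the coinvariants `coinvariantsAt x` (the variant of Rem. 4.12.6 on which the route
  posits semisimplicity of Sen), `IsSenSemisimpleOn`.
* The properties, one predicate each, each citing the printed statement it transcribes:
  `IsFiniteProjective`, `HasDuality` (Thm. 7.3.1 (1), (4)), `HasHidaColemanComparison`
  (Thm. 7.3.1 (3)), `HasGaloisFamily` (Prop. 7.4.8: `det(X − ρ(Frob_l)) = Q_l(X)` over `𝕋`),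
  `IsLocalisedAt θ ρ̄` (non-Eisenstein localisation), `GaloisSymplectic` (`ν ∘ ρ = ε⁻¹`),
  `ClassicalPointsAutomorphic` and `CousinKernelAutomorphic` (classical eigensystems are
  automorphic, in the GL₄ idiom `Aut` of the route = `IsAutomorphicAE` of the tree, VERBATIM),
  `HasHeckeEquivariantCousin`, `HasEichlerShimura` (Thm. 4.9.7), `HasSenOperator` (Thm. 4.9.7,
  scalars `a, a, a+1, a+1`), `HasSenCousin` (Thm. 4.10.4).
* `trivial` — the zero datum (non-vacuity of the TYPE; it is why no existence fact is minted here).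

## Design notes

* One datum = one tame level `K^p` and one (non-Eisenstein) localisation; `K^p` enters only
  through `S`, as in `Eigenvariety`.  All cohomology groups are taken at the weight-`(2,2)`
  character `λ = algebraMap Λ ℚ̄_p` of `T(ℤ_p)` (trivial-Nebentypus part, where `M_w ⊗_{Λ,λ} ℚ̄_p`
  lives by Thm. 7.3.1 (3)), so that `H i` and `V` are finite-dimensional in the intended model
  (proof of Lemma 4.12.3: "`V_{ℂ_p}[χ]` is finite-dimensional").
* Why `[Algebra Λ ℚ̄_p]` as a parameter: the only specialisation of `Λ` whose FIBRES the socle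
  argument needs is the weight-`(2,2)` one; carrying it as the algebra structure makes
  `ℚ̄_p ⊗[Λ] M i` an honest `ℚ̄_p`-vector space with no auxiliary type synonym; classical REGULAR
  weights are visible only through the set of classical points (Thm. 7.3.1 (2) has no carrier:
  no Siegel modular forms in the tree).
* `ℂ_p` is Mathlib's `PadicComplex p`, an algebra over `PadicAlgCl p = ℚ̄_p`.
* Indexing: `M i`, `H i` by `i : Fin 4 = ℓ(w)`; duality pairs `i` with `Fin.rev i = 3 − i`
  (`ℓ(w₀ᴹ w w₀) = 3 − ℓ(w)`).
* Junk / vacuity, documented: `heckeT v i` is meaningful only for `v ∉ S` not above `p`;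
  `galoisRep x` only where `HasGaloisFamily` holds; `trivial` satisfies the module-theoretic
  properties vacuously and `GaloisSymplectic`/automorphy properties need not hold for it.
* NOT here: the construction ([BoxerPilloni2025]); Thm. 7.3.1 (2) (control at dominant weights)
  and (5) (change of level); `D_Sen(ρ_x)` and the Galois action on `V` (Lemma 4.12.3
  `V[𝔪_f] ≅ ρ_f ⊗ W`: no Sen theory of Galois representations in the tree — the route states the
  semisimplicity it needs on `torsionAt` / `coinvariantsAt` via `IsSenSemisimpleOn`); the Sen map
  in degrees `0 → 1` (defined in §4.10.3, but Thm. 4.10.4 is printed for `2 → 3` only, cf.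
  Rem. 4.12.6); Taylor–Wiles patching and every `R = 𝕋` statement.

## References

* G. Boxer, F. Calegari, T. Gee, V. Pilloni, *Modularity theorems for abelian surfaces*,
  arXiv:2502.20645 (2025): §1.3; §1.8.9; §4.9 Thm. 4.9.7 (267); §4.10 Prop. 4.10.1 (268),
  Prop. 4.10.2 (269), Rem. 4.10.3 (270), Thm. 4.10.4 (271); §4.12 Lemma 4.12.3 (276), Thm. 4.12.4
  (277), Rem. 4.12.5–6 (278–279); §7.3 Thm. 7.3.1 (347), Rem. 7.3.3–4 (349–350); §7.4 Prop. 7.4.8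
  (362). [BoxerCalegariGeePilloni2025]
* G. Boxer, F. Calegari, T. Gee, V. Pilloni, *Abelian surfaces over totally real fields are
  potentially modular*, Publ. Math. IHÉS 134 (2021), arXiv:1812.09269: §2.1, §2.4.3, Thm. 2.7.1,
  §2.9 (Lemma 2.9.1, Thm. 2.9.3), §7.9 (`Q_v(X)`, Thm. 7.9.x = Thm. 330). [BoxerEtAl2021]
* G. Boxer, V. Pilloni, *Higher Hida theory for Siegel modular forms* (the `boxer2023higher` of
  BCGP). [BoxerPilloni2025]
* J. Arthur, *The endoscopic classification of representations* (2013); T. Gee, O. Taïbi,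
  *Arthur's multiplicity formula for GSp₄ and restriction to Sp₄* (2019). [Arthur2013] [GeeTaibi2019]
-/

noncomputable section

open scoped NumberField Polynomial TensorProduct
open Field IsDedekindDomain

namespace Literature.NumberTheory.Automorphic

/-! ### The spherical Hecke polynomial of `GSp₄` -/

section HeckePoly

variable {A B : Type*} [CommRing A] [CommRing B]

/-- **The spherical Hecke polynomial `Q_v(X)` of `GSp₄`** at a place of residue cardinality `q`,
in the eigenvalues `t₀, t₁, t₂` of `T_{v,0}, T_{v,1}, T_{v,2}`:
`X⁴ − t₁ X³ + (q t₂ + (q³ + q) t₀) X² − q³ t₀ t₁ X + q⁶ t₀²` — the characteristic polynomial of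
`rec_{GT,p}(π_v ⊗ |ν|^{-3/2})(Frob_v)` (geometric Frobenius) for an unramified `π_v` with these
eigenvalues, and the polynomial `Q_v(X) ∈ 𝕋[X]` pinning Galois representations over Hecke
algebras. [cite: BoxerEtAl2021, §2.4.3 and §7.9] -/
def gsp4FrobPoly (q : ℕ) (t : Fin 3 → A) : A[X] :=
  Polynomial.X ^ 4 - Polynomial.C (t 1) * Polynomial.X ^ 3 +
    Polynomial.C ((q : A) * t 2 + ((q : A) ^ 3 + q) * t 0) * Polynomial.X ^ 2 -
    Polynomial.C ((q : A) ^ 3 * t 0 * t 1) * Polynomial.X + Polynomial.C ((q : A) ^ 6 * t 0 ^ 2)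

/-- `gsp4FrobPoly` commutes with ring homomorphisms (change of coefficients). [folklore] -/
theorem gsp4FrobPoly_map (f : A →+* B) (q : ℕ) (t : Fin 3 → A) :
    (gsp4FrobPoly q t).map f = gsp4FrobPoly q (f ∘ t) := by
  simp [gsp4FrobPoly, Polynomial.map_sub, Polynomial.map_add, Polynomial.map_mul,
    Polynomial.map_pow]

/-- `Q_v` is monic. [cite: BoxerEtAl2021, §2.4.3] -/
theorem monic_gsp4FrobPoly [Nontrivial A] (q : ℕ) (t : Fin 3 → A) : (gsp4FrobPoly q t).Monic := by
  unfold gsp4FrobPoly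
  monicity!

/-- `Q_v` has degree `4`. [cite: BoxerEtAl2021, §2.4.3] -/
theorem natDegree_gsp4FrobPoly [Nontrivial A] (q : ℕ) (t : Fin 3 → A) :
    (gsp4FrobPoly q t).natDegree = 4 := by
  unfold gsp4FrobPoly
  compute_degree!

end HeckePoly

/-! ### "Associated through `Q_v`" (dot-notation extension of the accepted `FramedGaloisRep`,
declared by absolute name, CONVENTIONS §2) -/

section Associated

variable {A : Type*} [CommRing A] [TopologicalSpace A]

/-- **`ρ : Γ_ℚ → GL₄(A)` and the `GSp₄` Hecke eigenvalues `t` are associated at `v`**: `ρ` is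
unramified at `v` and the characteristic polynomial of a GEOMETRIC Frobenius at `v` is the spherical
Hecke polynomial `Q_v(t)` (`gsp4FrobPoly`) — the shape of `det(X − ρ(Frob_l)) = Q_l(X)`
(BCGP 2025 Prop. 7.4.8, BCGP 2021 §7.9) in BCGP's convention "`Frob_K` the geometric Frobenius,
`Art_K` sends uniformisers to geometric Frobenius elements" (BCGP 2021 §2.1).  The tree's Frobenii
are arithmetic (`IsArithFrobAt`, accepted `HasFrobCharpolyAt`), so the identity is imposed on
`ρ(σ⁻¹)` for every arithmetic Frobenius `σ` at every prime of `\bar ℤ` above `v` (the rendering of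
`FramedGaloisRep.IsHeckeAssociatedAt` in `Eigenvariety`).  Dot-notation extension of the accepted
`GaloisRepresentations.FramedGaloisRep`, declared here by absolute name.
[cite: BoxerEtAl2021, §2.1, §2.4.3 and §7.9] [cite: BoxerCalegariGeePilloni2025, §7.4 Prop. 7.4.8 (= Prop. 362)] -/
def _root_.Literature.NumberTheory.GaloisRepresentations.FramedGaloisRep.IsGSp4HeckeAssociatedAt
    (ρ : GaloisRepresentations.FramedGaloisRep ℚ A 4) (v : HeightOneSpectrum (𝓞 ℚ)) (t : Fin 3 → A) :
    Prop :=
  ρ.IsUnramifiedAt v ∧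
    ∀ 𝔓 ∈ v.primesAbove, ∀ σ : absoluteGaloisGroup ℚ, IsArithFrobAt (𝓞 ℚ) σ 𝔓 →
      GaloisRepresentations.FramedRep.charpoly ρ σ⁻¹ = gsp4FrobPoly v.residueCard t

/-- An associated `ρ` is unramified at `v` (first clause). [cite: BoxerEtAl2021, Thm. 2.7.1] -/
theorem _root_.Literature.NumberTheory.GaloisRepresentations.FramedGaloisRep.IsGSp4HeckeAssociatedAt.isUnramifiedAt
    {ρ : GaloisRepresentations.FramedGaloisRep ℚ A 4} {v : HeightOneSpectrum (𝓞 ℚ)} {t : Fin 3 → A}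
    (h : ρ.IsGSp4HeckeAssociatedAt v t) : ρ.IsUnramifiedAt v :=
  h.1

/-- The characteristic-polynomial clause of `IsGSp4HeckeAssociatedAt`. [cite: BoxerEtAl2021, §7.9] -/
theorem _root_.Literature.NumberTheory.GaloisRepresentations.FramedGaloisRep.IsGSp4HeckeAssociatedAt.charpoly_inv_eq
    {ρ : GaloisRepresentations.FramedGaloisRep ℚ A 4} {v : HeightOneSpectrum (𝓞 ℚ)} {t : Fin 3 → A}
    (h : ρ.IsGSp4HeckeAssociatedAt v t) {𝔓 : Ideal (GaloisRepresentations.absIntegers (𝓞 ℚ) ℚ)}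
    (h𝔓 : 𝔓 ∈ v.primesAbove) {σ : absoluteGaloisGroup ℚ} (hσ : IsArithFrobAt (𝓞 ℚ) σ 𝔓) :
    GaloisRepresentations.FramedRep.charpoly ρ σ⁻¹ = gsp4FrobPoly v.residueCard t :=
  h.2 𝔓 h𝔓 σ hσ

end Associated

/-! ### The datum -/

/-- **An ordinary higher Hida datum for `GSp₄/ℚ` at `p` with bad places `S`** (one neat tame level
`K^p` with `S = S(K^p)`, no place above `p` in `S`, one non-Eisenstein localisation): the arithmetic
shadow of Boxer–Pilloni's ordinary higher Hida theory of the Siegel threefold together with BCGP's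
weight-`(2,2)` structures, over

* `Λ` — the coefficient ring (intended `𝒪[[T(ℤ_p)]]`, `T ≅ 𝔾_m³` the diagonal torus of `GSp₄`),
  GIVEN WITH its weight-`(2,2)` specialisation as the structure map `algebraMap Λ ℚ̄_p` (the
  character `λ = (1,1;w)` of `T(ℤ_p)` twisted as in Thm. 7.3.1 (3), at which weight-`(2,2)` ordinary
  `p`-adic forms live);
* `𝕋` — a commutative `Λ`-algebra (intended: the `Λ[T(ℚ_p)/T(ℤ_p)] ⊗ 𝕋^p`-algebra generated by the
  Hecke operators acting on everything below, localised; diamond operators `⟨t⟩`, `t ∈ T(ℤ_p)`,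
  are the `Λ`-structure),

namely the DATA

* `heckeT v i = T_{v,i}` (`v ∉ S` not above `p`, `i = 0,1,2`; BCGP 2021 §2.4.3) and
  `heckeU i = U_{p,i}` (the operators of `β_{p,i} ∈ T⁺(ℚ_p)`, matched with `[Iw(p) β_{p,i} Iw(p)]`:
  `U_{p,1}` Klingen, `U_{p,2}` Siegel, `U_{p,0}` central; BCGP 2025 Rem. 7.3.3) in `𝕋`;
* `M i` — the Hida module `M_{w_i}` (`w_i ∈ W^M` the Kostant representative of length `i`;
  BCGP 2025 §7.3: `H^{ℓ(w)}` of the Hida complex `M^•_{w,cusp}` for `ℓ(w) = 0,1`, of `M^•_w` for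
  `ℓ(w) = 2,3`, `⊗ 𝒪`), a `𝕋`-module;
* `H i` — the ordinary weight-`(2,2)` higher Coleman cohomology in degree `i` at the character `λ`
  (`H^i_{w_i}(Sh^tor_{K^p}, ω^{κ_i,sm}(−D)ⁱ)^{ord, T(ℤ_p)}_𝔪`, `κ₀ = κ₁ = (2,2;−w)` cuspidal,
  `κ₂ = κ₃ = (1,1;−w)`, the right-hand sides of Thm. 7.3.1 (3), identified with the big-sheaf
  spaces `Gr^i V_{ℂ_p}` of Thm. 4.9.7 by Prop. 4.10.2 / Rem. 4.10.3), a `ℚ̄_p`-space with Hecke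
  action `heckeH i`; `hidaToColeman i : ℚ̄_p ⊗_{Λ,λ} M i → H i`, the comparison map of Thm. 7.3.1 (3);
  the COUSIN differentials `cousinLow : H 0 → H 1` and `cousinHigh : H 2 → H 3` of the two-term
  ordinary complexes (Prop. 4.10.1 (2), Rem. 4.10.3);
* `V` — the ordinary `𝔟`-cohomology `H³(RHom_𝔟(λ, RΓ(Sh^tor_{K^p}, ℚ̄_p)^la)^ord_𝔪)[λ|_{T(ℤ_p)}]`
  (Thm. 4.9.7, Thm. 4.12.4; Nebentypus part as in the proof of Lemma 4.12.3), a `ℚ̄_p`-space with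
  Hecke action `heckeV`; on `V_{ℂ_p} = ℂ_p ⊗ V` the decreasing `p`-adic Eichler–Shimura filtration
  `fil` (`Fil⁰ ⊇ Fil¹ ⊇ Fil² ⊇ Fil³ ⊇ 0`), the arithmetic Sen operator `sen = Θ`, and the
  Eichler–Shimura maps `gradedToColeman i : fil i → ℂ_p ⊗ H i` (intended surjective with kernel
  `fil (i+1)`: `Gr^i V_{ℂ_p} ≅ ℂ_p ⊗ H i`, Thm. 4.9.7);
* `galoisRep x` — the Galois representation `ρ_x : Γ_ℚ → GL₄(ℚ̄_p)` of a `ℚ̄_p`-point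
  `x : 𝕋 →+* ℚ̄_p` (specialisation of `ρ : G_ℚ → GSp₄(𝕋)`, Prop. 7.4.8; a datum, meaningful where
  `HasGaloisFamily` holds), and `classicalPt`, the set of classical points (eigensystems occurring
  in the classical coherent cohomology `H^{ℓ(w)}(Sh^tor_{Iw(p)K^p}, ω^κ)^ord` of a dominant
  algebraic weight, Thm. 7.3.1 (2)).

No theorem and no existence statement is a field: the properties proved by Boxer–Pilloni and BCGP
are the predicates `IsFiniteProjective`, `HasDuality`, `HasHidaColemanComparison`,
`HasGaloisFamily`, `IsLocalisedAt`, `GaloisSymplectic`, `ClassicalPointsAutomorphic`,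
`CousinKernelAutomorphic`, `HasHeckeEquivariantCousin`, `HasEichlerShimura`, `HasSenOperator`,
`HasSenCousin` below; the type is inhabited by the zero datum `trivial`.
[cite: BoxerCalegariGeePilloni2025, §7.3 Thm. 7.3.1 (= Thm. 347); §4.9 Thm. 4.9.7 (= Thm. 267); §4.10; §4.12 Thm. 4.12.4 (= Thm. 277)] [cite: BoxerPilloni2025, Introduction] -/
structure OrdinaryHigherHidaGSp4 (p : ℕ) [Fact p.Prime] (S : Set (HeightOneSpectrum (𝓞 ℚ)))
    (Λ : Type) [CommRing Λ] [Algebra Λ (PadicAlgCl p)] (𝕋 : Type) [CommRing 𝕋] [Algebra Λ 𝕋] :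
    Type 1 where
  /-- `heckeT v i = T_{v,i}`, the spherical Hecke operator of `β_{v,i}` at `v ∉ S` not above `p`
  (`i = 0, 1, 2`; junk elsewhere). -/
  heckeT : HeightOneSpectrum (𝓞 ℚ) → Fin 3 → 𝕋
  /-- `heckeU i = U_{p,i}`, the operator of `β_{p,i} ∈ T⁺(ℚ_p)` (`U_{p,1}` Klingen, `U_{p,2}` Siegel). -/
  heckeU : Fin 3 → 𝕋
  /-- `M i = M_{w_i}`, the ordinary higher Hida module in degree `i = ℓ(w_i)`, a `𝕋`-module. -/
  M : Fin 4 → ModuleCat.{0} 𝕋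
  /-- `H i`, the ordinary weight-`(2,2)` higher Coleman cohomology in degree `i` (at the character
  `λ = algebraMap Λ ℚ̄_p`). -/
  H : Fin 4 → ModuleCat.{0} (PadicAlgCl p)
  /-- The Hecke action on `H i`. -/
  heckeH : (i : Fin 4) → 𝕋 →+* Module.End (PadicAlgCl p) (H i)
  /-- The comparison map "higher Hida at the weight-`(2,2)` character → higher Coleman",
  `ℚ̄_p ⊗_{Λ,λ} M i → H i` (Thm. 7.3.1 (3)). -/
  hidaToColeman : (i : Fin 4) →
    (PadicAlgCl p) ⊗[Λ] (RestrictScalars Λ 𝕋 (M i)) →ₗ[PadicAlgCl p] (H i)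
  /-- The Cousin differential in degrees `[0,1]` (sheaf `ω^{(2,2;−w),sm}(−D)`). -/
  cousinLow : (H 0) →ₗ[PadicAlgCl p] (H 1)
  /-- The Cousin differential in degrees `[2,3]` (sheaf `ω^{(1,1;−w),sm}`). -/
  cousinHigh : (H 2) →ₗ[PadicAlgCl p] (H 3)
  /-- The ordinary `𝔟`-cohomology `V` (degree `3`), a `ℚ̄_p`-space. -/
  V : ModuleCat.{0} (PadicAlgCl p)
  /-- The Hecke action on `V`. -/
  heckeV : 𝕋 →+* Module.End (PadicAlgCl p) V
  /-- The decreasing `p`-adic Eichler–Shimura filtration of `V_{ℂ_p}` (`fil 0 = ⊤`, `fil 4 = ⊥`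
  intended). -/
  fil : ℕ → Submodule (PadicComplex p) ((PadicComplex p) ⊗[PadicAlgCl p] V)
  /-- The arithmetic Sen operator `Θ` on `V_{ℂ_p}`. -/
  sen : Module.End (PadicComplex p) ((PadicComplex p) ⊗[PadicAlgCl p] V)
  /-- The Eichler–Shimura map `fil i → ℂ_p ⊗ H i` (intended: surjective, kernel `fil (i+1)`). -/
  gradedToColeman : (i : Fin 4) →
    (fil i) →ₗ[PadicComplex p] ((PadicComplex p) ⊗[PadicAlgCl p] (H i))
  /-- The Galois representation `ρ_x` of a `ℚ̄_p`-point `x` of `𝕋`. -/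
  galoisRep : (𝕋 →+* PadicAlgCl p) → GaloisRepresentations.FramedGaloisRep ℚ (PadicAlgCl p) 4
  /-- The classical points of `𝕋` (eigensystems in classical coherent cohomology of a dominant
  algebraic weight). -/
  classicalPt : Set (𝕋 →+* PadicAlgCl p)

namespace OrdinaryHigherHidaGSp4

variable {p : ℕ} [Fact p.Prime] {S : Set (HeightOneSpectrum (𝓞 ℚ))} {Λ : Type} [CommRing Λ]
  [Algebra Λ (PadicAlgCl p)] {𝕋 : Type} [CommRing 𝕋] [Algebra Λ 𝕋]

/-! ### Points and fibres -/

/-- **`x` is a weight-`(2,2)` point**: the `ℚ̄_p`-point `x : 𝕋 →+* ℚ̄_p` lies over the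
weight-`(2,2)` specialisation of `Λ` (its restriction to the diamond operators is the character `λ`
of `T(ℤ_p)` carried by `algebraMap Λ ℚ̄_p`).  Every ring homomorphism to the field `ℚ̄_p` of
characteristic zero is a "characteristic-zero point". [cite: BoxerCalegariGeePilloni2025, §7.3 Thm. 7.3.1 (3) and §4.12 Thm. 4.12.4] -/
def IsWeightTwoPoint (_D : OrdinaryHigherHidaGSp4 p S Λ 𝕋) (x : 𝕋 →+* PadicAlgCl p) : Prop :=
  x.comp (algebraMap Λ 𝕋) = algebraMap Λ (PadicAlgCl p)

/-- **`x` is a characteristic-zero point of `𝕋` localised at `𝔪`**: the point factors through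
`𝕋_𝔪`, i.e. its kernel (a prime of residue characteristic zero) is contained in `𝔪`.
[cite: BoxerCalegariGeePilloni2025, §7.3–7.4] -/
def IsPointAt (_D : OrdinaryHigherHidaGSp4 p S Λ 𝕋) (𝔪 : Ideal 𝕋) (x : 𝕋 →+* PadicAlgCl p) : Prop :=
  RingHom.ker x ≤ 𝔪

/-- `IsPointAt` is monotone in the ideal. [folklore] -/
theorem IsPointAt.mono {D : OrdinaryHigherHidaGSp4 p S Λ 𝕋} {𝔪 𝔪' : Ideal 𝕋}
    {x : 𝕋 →+* PadicAlgCl p} (h : D.IsPointAt 𝔪 x) (h' : 𝔪 ≤ 𝔪') : D.IsPointAt 𝔪' x :=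
  le_trans h h'

/-- Every point is a point of `𝕋` localised at its own kernel. [folklore] -/
theorem isPointAt_ker (D : OrdinaryHigherHidaGSp4 p S Λ 𝕋) (x : 𝕋 →+* PadicAlgCl p) :
    D.IsPointAt (RingHom.ker x) x :=
  le_rfl

/-- **The weight-`(2,2)` fibre of `H i` at the point `x`** ("the weight-`(2,2)` fibre of `M^{(i)}`
at `x`", read on the Coleman side): the `x`-GENERALISED eigenspace of the Hecke action on `H i`,
i.e. the localisation at the maximal ideal `𝔪_x` of the `𝕋 ⊗ ℚ̄_p`-module `H i` — a module over
the Artinian local Hecke fibre `A = 𝕋_x/P` of the route. [cite: BoxerCalegariGeePilloni2025, §4.12 Thm. 4.12.4 (proof: "we pass to 𝔪_f-isotypic components")] -/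
def fibreAt (D : OrdinaryHigherHidaGSp4 p S Λ 𝕋) (i : Fin 4) (x : 𝕋 →+* PadicAlgCl p) :
    Submodule (PadicAlgCl p) (D.H i) :=
  ⨅ t : 𝕋, (D.heckeH i t).maxGenEigenspace (x t)

/-- **The weight-`(2,2)` eigenspace of `H i` at `x`** (`H i[𝔪_x]`, the `𝔪_x`-torsion: honest
common eigenvectors). [cite: BoxerCalegariGeePilloni2025, §4.12 Thm. 4.12.4] -/
def eigenspaceAt (D : OrdinaryHigherHidaGSp4 p S Λ 𝕋) (i : Fin 4) (x : 𝕋 →+* PadicAlgCl p) :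
    Submodule (PadicAlgCl p) (D.H i) :=
  ⨅ t : 𝕋, (D.heckeH i t).eigenspace (x t)

/-- Eigenvectors are generalised eigenvectors: `H i[𝔪_x] ≤` the fibre at `x`. [folklore] -/
theorem eigenspaceAt_le_fibreAt (D : OrdinaryHigherHidaGSp4 p S Λ 𝕋) (i : Fin 4)
    (x : 𝕋 →+* PadicAlgCl p) : D.eigenspaceAt i x ≤ D.fibreAt i x :=
  iInf_mono fun t => (D.heckeH i t).eigenspace_le_maxGenEigenspace

/-- **The weight-`(2,2)` fibre of the Hida module `M i` at `x`**, on the Hida side: the image of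
`ℚ̄_p ⊗_{Λ,λ} M i` under the comparison map, cut down to the `x`-generalised eigenspace (equal to
`fibreAt` under `HasHidaColemanComparison`). [cite: BoxerCalegariGeePilloni2025, §7.3 Thm. 7.3.1 (3)] -/
def hidaFibreAt (D : OrdinaryHigherHidaGSp4 p S Λ 𝕋) (i : Fin 4) (x : 𝕋 →+* PadicAlgCl p) :
    Submodule (PadicAlgCl p) (D.H i) :=
  LinearMap.range (D.hidaToColeman i) ⊓ D.fibreAt i x

/-- The Hida-side fibre is contained in the Coleman-side fibre. [folklore] -/
theorem hidaFibreAt_le_fibreAt (D : OrdinaryHigherHidaGSp4 p S Λ 𝕋) (i : Fin 4)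
    (x : 𝕋 →+* PadicAlgCl p) : D.hidaFibreAt i x ≤ D.fibreAt i x :=
  inf_le_right

/-- **Cyclicity of the weight-`(2,2)` fibre at `x`** (the shape of the route's `FibreCyclicity`):
some vector of the fibre generates it under the Hecke algebra, i.e. the fibre is a cyclic module
over the Artinian Hecke fibre `A`. [folklore] -/
def IsCyclicAt (D : OrdinaryHigherHidaGSp4 p S Λ 𝕋) (i : Fin 4) (x : 𝕋 →+* PadicAlgCl p) : Prop :=
  ∃ m ∈ D.fibreAt i x,
    Submodule.span (PadicAlgCl p) (Set.range fun t : 𝕋 => D.heckeH i t m) = D.fibreAt i x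

/-! ### The `𝔟`-cohomology at a point: torsion, generalised eigenspace, coinvariants -/

/-- `V_{ℂ_p} = ℂ_p ⊗_{ℚ̄_p} V`. [cite: BoxerCalegariGeePilloni2025, §4.9 Thm. 4.9.7] -/
abbrev VC (D : OrdinaryHigherHidaGSp4 p S Λ 𝕋) : Type :=
  (PadicComplex p) ⊗[PadicAlgCl p] D.V

/-- The Hecke action on `V_{ℂ_p}` (base change of `heckeV`). [folklore] -/
def heckeVC (D : OrdinaryHigherHidaGSp4 p S Λ 𝕋) (t : 𝕋) : Module.End (PadicComplex p) D.VC :=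
  (D.heckeV t).baseChange (PadicComplex p)

/-- Unfolding lemma for `heckeVC` on pure tensors. [folklore] -/
@[simp]
theorem heckeVC_tmul (D : OrdinaryHigherHidaGSp4 p S Λ 𝕋) (t : 𝕋) (c : PadicComplex p) (v : D.V) :
    D.heckeVC t (c ⊗ₜ v) = c ⊗ₜ (D.heckeV t v) :=
  rfl

/-- **The `x`-torsion `V_{ℂ_p}[𝔪_x]`** of the `𝔟`-cohomology: common eigenvectors of the Hecke
action with eigensystem `x` (the space of hypothesis (3) of Thm. 4.12.4 and of Lemma 4.12.3,
`V[𝔪_f] ≅ ρ_f ⊗ W`). [cite: BoxerCalegariGeePilloni2025, §4.12 Thm. 4.12.4 and Lemma 4.12.3 (= Lemma 276)] -/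
def torsionAt (D : OrdinaryHigherHidaGSp4 p S Λ 𝕋) (x : 𝕋 →+* PadicAlgCl p) :
    Submodule (PadicComplex p) D.VC :=
  ⨅ t : 𝕋, (D.heckeVC t).eigenspace (algebraMap (PadicAlgCl p) (PadicComplex p) (x t))

/-- **The `x`-generalised eigenspace of `V_{ℂ_p}`** (localisation at `𝔪_x`). [folklore] -/
def genEigenspaceV (D : OrdinaryHigherHidaGSp4 p S Λ 𝕋) (x : 𝕋 →+* PadicAlgCl p) :
    Submodule (PadicComplex p) D.VC :=
  ⨅ t : 𝕋, (D.heckeVC t).maxGenEigenspace (algebraMap (PadicAlgCl p) (PadicComplex p) (x t))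

/-- Torsion is contained in the generalised eigenspace. [folklore] -/
theorem torsionAt_le_genEigenspaceV (D : OrdinaryHigherHidaGSp4 p S Λ 𝕋) (x : 𝕋 →+* PadicAlgCl p) :
    D.torsionAt x ≤ D.genEigenspaceV x :=
  iInf_mono fun t => (D.heckeVC t).eigenspace_le_maxGenEigenspace

/-- **`𝔪_x V_{ℂ_p}`**: the span of the images of `t − x(t)`, `t ∈ 𝕋`. [cite: BoxerCalegariGeePilloni2025, §4.12 Rem. 4.12.6 (= Rem. 279)] -/
def maximalIdealImage (D : OrdinaryHigherHidaGSp4 p S Λ 𝕋) (x : 𝕋 →+* PadicAlgCl p) :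
    Submodule (PadicComplex p) D.VC :=
  ⨆ t : 𝕋, LinearMap.range
    (D.heckeVC t - algebraMap (PadicAlgCl p) (PadicComplex p) (x t) • LinearMap.id)

/-- **The coinvariants `V_{ℂ_p} / 𝔪_x V_{ℂ_p}`** — the variant of Rem. 4.12.6 ("one would consider
`V/𝔪_f V` instead of `V[𝔪_f]`") on which route `RepeatedRootSocle` posits the semisimplicity of the
Sen operator. [cite: BoxerCalegariGeePilloni2025, §4.12 Rem. 4.12.6 (= Rem. 279)] -/
abbrev coinvariantsAt (D : OrdinaryHigherHidaGSp4 p S Λ 𝕋) (x : 𝕋 →+* PadicAlgCl p) : Type :=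
  D.VC ⧸ D.maximalIdealImage x

/-- **The Sen operator is semisimple on the `Θ`-stable subspace `W ≤ V_{ℂ_p}`** (quantified over
the witnesses of stability, a proof-irrelevant device): the translation of "`ρ|_{G_{ℚ_p}}` is de
Rham", which in the ordinary weight-`2` case "means that the Sen operator of `D_Sen(ρ_f|_{G_{ℚ_p}})`
is semi-simple", used on `W = V_{ℂ_p}[𝔪_f] = D_Sen(ρ_f)^{⊕n}` in the proof of Thm. 4.12.4.
[cite: BoxerCalegariGeePilloni2025, §4.12 (before Thm. 4.12.4) and Thm. 4.12.4 (proof)] -/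
def IsSenSemisimpleOn (D : OrdinaryHigherHidaGSp4 p S Λ 𝕋) (W : Submodule (PadicComplex p) D.VC) :
    Prop :=
  ∀ hW : ∀ v ∈ W, D.sen v ∈ W, Module.End.IsSemisimple (D.sen.restrict hW)

/-! ### The properties (theorems of Boxer–Pilloni and BCGP about their construction) -/

section Properties

/-- **Thm. 7.3.1 (1)**: "The modules `M_w` are finite projective `𝒪[[T(ℤ_p)]]`-modules."
[cite: BoxerCalegariGeePilloni2025, §7.3 Thm. 7.3.1 (1) (= Thm. 347 (1))] -/
def IsFiniteProjective (D : OrdinaryHigherHidaGSp4 p S Λ 𝕋) : Prop :=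
  ∀ i : Fin 4, Module.Finite Λ (RestrictScalars Λ 𝕋 (D.M i)) ∧
    Module.Projective Λ (RestrictScalars Λ 𝕋 (D.M i))

/-- **Thm. 7.3.1 (4)**: "We have a perfect duality pairing `M_w ⊗ M_{w_{0,M} w w_0} → 𝒪[[T(ℤ_p)]]`
interpolating the classical Serre duality" — a perfect `Λ`-bilinear pairing between the degree-`i`
and degree-`3−i` modules (`ℓ(w_{0,M} w w_0) = 3 − ℓ(w)`); Hecke-adjointness is not part of the
printed statement and is not imposed.  Spelled as the two bijectivity clauses of Mathlib's
`LinearMap.IsPerfPair` (`M ≅ Hom_Λ(N, Λ)` and `N ≅ Hom_Λ(M, Λ)`). [cite: BoxerCalegariGeePilloni2025, §7.3 Thm. 7.3.1 (4) (= Thm. 347 (4))] -/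
def HasDuality (D : OrdinaryHigherHidaGSp4 p S Λ 𝕋) : Prop :=
  ∀ i : Fin 4, ∃ B : RestrictScalars Λ 𝕋 (D.M i) →ₗ[Λ] RestrictScalars Λ 𝕋 (D.M (Fin.rev i)) →ₗ[Λ] Λ,
    Function.Bijective B ∧ Function.Bijective B.flip

/-- **Thm. 7.3.1 (3) at the weight-`(2,2)` character** (comparison of higher Hida and higher
Coleman theory): the comparison map `ℚ̄_p ⊗_{Λ,λ} M i → H i` is a HECKE-EQUIVARIANT ISOMORPHISM
("there are Hecke equivariant isomorphisms `M_w ⊗_{𝒪[[T(ℤ_p)]],λ} E(−λ) =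
H^{ℓ(w)}_w(Sh^tor_{K^p}, ω^{κ,sm}(−D))^{ord,T(ℤ_p)}`"). [cite: BoxerCalegariGeePilloni2025, §7.3 Thm. 7.3.1 (3) (= Thm. 347 (3))] -/
def HasHidaColemanComparison (D : OrdinaryHigherHidaGSp4 p S Λ 𝕋) : Prop :=
  ∀ i : Fin 4, Function.Bijective (D.hidaToColeman i) ∧
    ∀ t : 𝕋, D.hidaToColeman i ∘ₗ ((RestrictScalars.lsmul Λ 𝕋 (D.M i) t).baseChange (PadicAlgCl p)) =
      D.heckeH i t ∘ₗ D.hidaToColeman i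

/-- **Galois representations over the Hecke algebra, specialised at points** (BCGP 2025
Prop. 7.4.8 with `N = 0`: "a representation `ρ_𝒮 : G_ℚ → GSp₄(𝕋_𝒮)` determined by the property
that `det(X − ρ_𝒮(Frob_l)) = Q_l(X)` for all `l ∉ S`", `S ∋ p`; BCGP 2021 Thm. 7.9 (= Thm. 330) over
totally real fields): for every `ℚ̄_p`-point `x` of `𝕋` and every `v ∉ S` not above `p`, `ρ_x` is
unramified at `v` and associated with the eigenvalues `x(T_{v,i})` through `Q_v`
(`IsGSp4HeckeAssociatedAt`, geometric Frobenius). [cite: BoxerCalegariGeePilloni2025, §7.4 Prop. 7.4.8 (= Prop. 362)] [cite: BoxerEtAl2021, §7.9 Thm. 330] -/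
def HasGaloisFamily (D : OrdinaryHigherHidaGSp4 p S Λ 𝕋) : Prop :=
  ∀ x : 𝕋 →+* PadicAlgCl p, ∀ v : HeightOneSpectrum (𝓞 ℚ), v ∉ S → ((p : ℕ) : 𝓞 ℚ) ∉ v.asIdeal →
    (D.galoisRep x).IsGSp4HeckeAssociatedAt v fun i => x (D.heckeT v i)

/-- **The datum is localised at `ρ̄`** (non-Eisenstein localisation at `𝔪_ρ̄`, "the ideal …
which contains the coefficients of `det(X − ρ̄(Frob_v)) − Q_v(X)` for each `v`"): at every
`v ∉ S` not above `p` the eigenvalues `x(T_{v,i})` of every point are `p`-integral with reductions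
`t̄_{v,i}` through `θ : \bar ℤ_p → k`, and `ρ̄` is associated with `t̄` at `v` (same convention on
both sides). [cite: BoxerEtAl2021, §7.9 (the ideal `\tilde 𝔪^{an}`)] [cite: BoxerCalegariGeePilloni2025, §7.4 (𝔪 and `Q_l`)] -/
def IsLocalisedAt (D : OrdinaryHigherHidaGSp4 p S Λ 𝕋) {k : Type*} [Field k] [TopologicalSpace k]
    (θ : (Valued.v : Valuation (PadicAlgCl p) NNReal).valuationSubring →+* k)
    (ρb : GaloisRepresentations.FramedGaloisRep ℚ k 4) : Prop :=
  ∀ x : 𝕋 →+* PadicAlgCl p, ∀ v : HeightOneSpectrum (𝓞 ℚ), v ∉ S → ((p : ℕ) : 𝓞 ℚ) ∉ v.asIdeal →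
    ∃ t : Fin 3 → (Valued.v : Valuation (PadicAlgCl p) NNReal).valuationSubring,
      (∀ i, ((t i : (Valued.v : Valuation (PadicAlgCl p) NNReal).valuationSubring) : PadicAlgCl p) =
          x (D.heckeT v i)) ∧
        ρb.IsGSp4HeckeAssociatedAt v (θ ∘ t)

/-- **The Galois representations are symplectic with multiplier `ε⁻¹`** ("`ν ∘ ρ_{π,p} = ε⁻¹`",
BCGP's standing normalisation with central character `|·|²`; over `𝕋`: `ρ_𝒮 : G_ℚ → GSp₄(𝕋_𝒮)` of
type `𝒮`, similitude `ε⁻¹`), in the VERBATIM idiom `Sympl` of route `RepeatedRootSocle`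
(`IsSymplecticWithMultiplierFun` with the inverse cyclotomic character pushed into `ℚ̄_p`).
[cite: BoxerCalegariGeePilloni2025, §1.8.9 (ν ∘ ρ_{π,p} = ε⁻¹) and §7.4 Prop. 7.4.8] [cite: BoxerEtAl2021, Thm. 2.7.1 (1)] -/
def GaloisSymplectic (D : OrdinaryHigherHidaGSp4 p S Λ 𝕋) : Prop :=
  ∀ x : 𝕋 →+* PadicAlgCl p,
    (D.galoisRep x).IsSymplecticWithMultiplierFun fun g =>
      algebraMap ℚ_[p] (PadicAlgCl p)
        ((((GaloisRepresentations.GaloisRep.cyclotomicCharacter ℚ p g)⁻¹ : ℤ_[p]ˣ) : ℤ_[p]) : ℚ_[p])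

/-- **Classical points are automorphic** (in the GL₄ idiom of the summit): the Galois representation
of every classical point matches, at almost all places, an L-algebraic CUSPIDAL automorphic
representation of `GL₄(𝔸_ℚ)` — verbatim the clause `Aut` of route `RepeatedRootSocle`
(definitionally `IsAutomorphicAE ι hcpt (D.galoisRep x)` of the tree, `isAutomorphicAE_iff`).  For
Boxer–Pilloni's datum localised at a non-Eisenstein `𝔪` this is: a classical eigensystem of
dominant weight is that of a cuspidal `π` on `GSp₄` of weight `(k,l)`, `k ≥ l > 2`, central
character `|·|²` (Thm. 7.3.1 (2)), with `ρ_{π,p}` (BCGP 2021 Thm. 2.7.1), `π` is of general type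
since otherwise its Galois representations are reducible (Lemma 2.9.1), hence transfers to a
cuspidal `Π` on `GL₄` with `rec(Π_v) = rec_{GT}(π_v)` (§2.9, Arthur / Gee–Taïbi).  `hcpt` only
types `π` (D-0014). [cite: BoxerEtAl2021, Thm. 2.7.1, §2.9 Lemma 2.9.1 and Thm. 2.9.3] [cite: BoxerCalegariGeePilloni2025, §7.3 Thm. 7.3.1 (2)] [cite: Arthur2013, Thm. 1.5.2] [cite: GeeTaibi2019, Thm. 7.4.1] -/
def ClassicalPointsAutomorphic (D : OrdinaryHigherHidaGSp4 p S Λ 𝕋)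
    (hcpt : isCompact_glFiniteIntegralLevel 4 ℚ) (ι : PadicAlgCl p ≃+* ℂ) : Prop :=
  ∀ x ∈ D.classicalPt, ∃ π : CuspidalAutomorphicRepData 4 ℚ hcpt, π.1.IsLAlgebraic ∧
    ∀ᶠ v : HeightOneSpectrum (𝓞 ℚ) in Filter.cofinite, ∃ a : Multiset ℂ,
      π.1.HasSatakeParamAt v a ∧ (D.galoisRep x).IsUnramifiedAt v ∧
        (D.galoisRep x).HasFrobCharpolyAt v (arithFrobPolyOfSatake ι v.residueCard 1 a)

/-- **Weight-`2` eigensystems in the kernel of the Cousin map are automorphic**: if a weight-`(2,2)`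
point `x` has a non-zero common eigenvector in `ker(Cous) ⊆ H 0` or in `ker(Cous) ⊆ H 2`, then
`ρ_x` is automorphic (clause `Aut` verbatim, as in `ClassicalPointsAutomorphic`).  In BCGP:
`ker(Cous)` on `H²_{²w}(ω^{(1,1;−w),sm})^ord[𝔪_f]` "is the space of classical forms" and dually
`H⁰(Sh^tor_{K^p}, ω^{(2,2;−w),sm})^ord = ker(Cous : H⁰_{⁰w} → H¹_{¹w})` (Prop. 4.10.1 (2),
Rem. 4.10.3, proof of Thm. 4.12.4); a classical weight-`2` ordinary cuspidal eigenform generates a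
cuspidal `π` of weight `(2,2)` whose `L`-packet is stable under the non-Eisenstein hypothesis
("by the stability of the `L`-packet of automorphic forms corresponding to `f`", Arthur), of general
type, whose transfer to `GL₄` together with `ρ_x` of `HasGaloisFamily` gives `Aut`.
[cite: BoxerCalegariGeePilloni2025, §4.10 Prop. 4.10.1 (2) and Rem. 4.10.3; §4.12 Thm. 4.12.4 (proof) and Rem. 4.12.6] [cite: BoxerEtAl2021, §2.9 Lemma 2.9.1 and Thm. 2.9.3] -/
def CousinKernelAutomorphic (D : OrdinaryHigherHidaGSp4 p S Λ 𝕋)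
    (hcpt : isCompact_glFiniteIntegralLevel 4 ℚ) (ι : PadicAlgCl p ≃+* ℂ) : Prop :=
  ∀ x : 𝕋 →+* PadicAlgCl p, D.IsWeightTwoPoint x →
    (D.eigenspaceAt 0 x ⊓ LinearMap.ker D.cousinLow ≠ ⊥ ∨
      D.eigenspaceAt 2 x ⊓ LinearMap.ker D.cousinHigh ≠ ⊥) →
    ∃ π : CuspidalAutomorphicRepData 4 ℚ hcpt, π.1.IsLAlgebraic ∧
      ∀ᶠ v : HeightOneSpectrum (𝓞 ℚ) in Filter.cofinite, ∃ a : Multiset ℂ,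
        π.1.HasSatakeParamAt v a ∧ (D.galoisRep x).IsUnramifiedAt v ∧
          (D.galoisRep x).HasFrobCharpolyAt v (arithFrobPolyOfSatake ι v.residueCard 1 a)

/-- **The Cousin maps are Hecke-equivariant** (the two-term complexes compute the ordinary
cohomology as Hecke modules; in the proof of Thm. 4.12.4 "we pass to `𝔪_f`-isotypic components").
[cite: BoxerCalegariGeePilloni2025, §4.10 Prop. 4.10.1 (2) and §4.12 Thm. 4.12.4 (proof)] -/
def HasHeckeEquivariantCousin (D : OrdinaryHigherHidaGSp4 p S Λ 𝕋) : Prop :=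
  (∀ t : 𝕋, D.cousinLow ∘ₗ D.heckeH 0 t = D.heckeH 1 t ∘ₗ D.cousinLow) ∧
    ∀ t : 𝕋, D.cousinHigh ∘ₗ D.heckeH 2 t = D.heckeH 3 t ∘ₗ D.cousinHigh

/-- **`p`-adic Eichler–Shimura (Thm. 4.9.7)**: "there is a `G_{ℚ_p} × 𝕋_{K^p} × T(ℚ_p)`-equivariant
filtration `{Fil^i V_{ℂ_p}}_{i=0,1,2,3}` on `V ⊗ ℂ_p` and `Gr^i V_{ℂ_p} =` (the ordinary higher
Coleman cohomology in degree `i`)": `fil` is decreasing and exhaustive/separated in four steps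
(`fil 0 = ⊤`, `fil n = ⊥` for `n ≥ 4`), Hecke-stable, and for each `i` the Eichler–Shimura map
`fil i → ℂ_p ⊗ H i` is surjective with kernel `fil (i+1)` and Hecke-equivariant — i.e.
`Gr^i V_{ℂ_p} ≅ ℂ_p ⊗ H i` as Hecke modules. [cite: BoxerCalegariGeePilloni2025, §4.9 Thm. 4.9.7 (= Thm. 267) and §4.10.3] -/
def HasEichlerShimura (D : OrdinaryHigherHidaGSp4 p S Λ 𝕋) : Prop :=
  Antitone D.fil ∧ D.fil 0 = ⊤ ∧ (∀ n : ℕ, 4 ≤ n → D.fil n = ⊥) ∧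
    (∀ (n : ℕ) (t : 𝕋), ∀ v ∈ D.fil n, D.heckeVC t v ∈ D.fil n) ∧
    ∀ i : Fin 4, Function.Surjective (D.gradedToColeman i) ∧
      (∀ v : D.fil i, D.gradedToColeman i v = 0 ↔ (v : D.VC) ∈ D.fil (i + 1)) ∧
      ∀ (t : 𝕋) (v : D.fil i) (hv : D.heckeVC t v ∈ D.fil i),
        D.gradedToColeman i ⟨D.heckeVC t v, hv⟩ =
          (D.heckeH i t).baseChange (PadicComplex p) (D.gradedToColeman i v)

/-- **The arithmetic Sen operator (Thm. 4.9.7, §4.10.3)**: `Θ` commutes with the Hecke action,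
preserves the filtration, and "is scalar on `Gr^i V_{ℂ_p}`", acting at `λ = (1,1;w)` by
`−2−w/2` on `Gr⁰, Gr¹` and by `−1−w/2` on `Gr², Gr³` ("a Sen operator whose eigenvalues are
`−1−w/2, −1−w/2, −2−w/2, −2−w/2`"): there is `a` (`= −2−w/2`) with `Θ − a` mapping `Fil⁰ → Fil¹`,
`Fil¹ → Fil²`, and `Θ − (a+1)` mapping `Fil² → Fil³`, `Fil³ → 0`. [cite: BoxerCalegariGeePilloni2025, §4.9 Thm. 4.9.7 (= Thm. 267, last assertion) and §4.10.3] -/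
def HasSenOperator (D : OrdinaryHigherHidaGSp4 p S Λ 𝕋) : Prop :=
  (∀ t : 𝕋, Commute D.sen (D.heckeVC t)) ∧ (∀ n : ℕ, ∀ v ∈ D.fil n, D.sen v ∈ D.fil n) ∧
    ∃ a : PadicComplex p,
      (∀ v ∈ D.fil 0, D.sen v - a • v ∈ D.fil 1) ∧ (∀ v ∈ D.fil 1, D.sen v - a • v ∈ D.fil 2) ∧
      (∀ v ∈ D.fil 2, D.sen v - (a + 1) • v ∈ D.fil 3) ∧ (∀ v ∈ D.fil 3, D.sen v = (a + 1) • v)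

/-- **Sen = Cousin (Thm. 4.10.4)**: "The two maps `Cous, Sen : H²_{²w}(…)^ord_𝔪 → H³_{³w}(…)^ord_𝔪`
agree up to a non-zero scalar", where `Sen` is the map `Gr² → Gr³ = Fil³` induced by the nilpotent
`Θ − b` (`b = −1−w/2`) on the generalised eigenspace `V_{ℂ_p}[(Θ−b)²] ⊇ Fil²` (§4.10.3): for some
scalar `b` with `Θ − b : Fil² → Fil³`, `Fil³ → 0`, and some `c ≠ 0`, the class of `(Θ − b)v` in
`Gr³ ≅ ℂ_p ⊗ H 3` is `c ·` Cousin of the class of `v ∈ Fil²` in `Gr² ≅ ℂ_p ⊗ H 2` (membership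
witnesses quantified, a proof-irrelevant device).  Printed for degrees `2 → 3` only (Rem. 4.12.6).
[cite: BoxerCalegariGeePilloni2025, §4.10.4 Thm. 4.10.4 (= Thm. 271) and §4.10.3] -/
def HasSenCousin (D : OrdinaryHigherHidaGSp4 p S Λ 𝕋) : Prop :=
  ∃ b c : PadicComplex p, c ≠ 0 ∧
    (∀ v ∈ D.fil 2, D.sen v - b • v ∈ D.fil 3) ∧ (∀ v ∈ D.fil 3, D.sen v = b • v) ∧
    ∀ (v : D.VC) (hv : v ∈ D.fil (2 : Fin 4)) (hv' : D.sen v - b • v ∈ D.fil (3 : Fin 4)),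
      D.gradedToColeman 3 ⟨D.sen v - b • v, hv'⟩ =
        c • (D.cousinHigh.baseChange (PadicComplex p)) (D.gradedToColeman 2 ⟨v, hv⟩)

end Properties

/-! ### API -/

/-- Under `HasEichlerShimura` the filtration is separated at step `4`. [cite: BoxerCalegariGeePilloni2025, §4.9 Thm. 4.9.7] -/
theorem HasEichlerShimura.fil_four {D : OrdinaryHigherHidaGSp4 p S Λ 𝕋} (h : D.HasEichlerShimura) :
    D.fil 4 = ⊥ :=
  h.2.2.1 4 le_rfl

/-- Under `HasEichlerShimura` every step of the filtration is contained in `fil 0 = V_{ℂ_p}` and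
the filtration is decreasing. [cite: BoxerCalegariGeePilloni2025, §4.9 Thm. 4.9.7] -/
theorem HasEichlerShimura.fil_succ_le {D : OrdinaryHigherHidaGSp4 p S Λ 𝕋} (h : D.HasEichlerShimura)
    (n : ℕ) : D.fil (n + 1) ≤ D.fil n :=
  h.1 (Nat.le_succ n)

/-- Under `HasSenOperator` the torsion `V_{ℂ_p}[𝔪_x]`, the generalised eigenspace and
`𝔪_x V_{ℂ_p}` are `Θ`-stable (so `IsSenSemisimpleOn` applies to them and `Θ` descends to the
coinvariants): here the torsion. [cite: BoxerCalegariGeePilloni2025, §4.12 Thm. 4.12.4 (proof)] -/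
theorem HasSenOperator.sen_mem_torsionAt {D : OrdinaryHigherHidaGSp4 p S Λ 𝕋} (h : D.HasSenOperator)
    (x : 𝕋 →+* PadicAlgCl p) {v : D.VC} (hv : v ∈ D.torsionAt x) : D.sen v ∈ D.torsionAt x := by
  simp only [torsionAt, Submodule.mem_iInf, Module.End.mem_eigenspace_iff] at hv ⊢
  intro t
  have hc := h.1 t
  calc D.heckeVC t (D.sen v) = D.sen (D.heckeVC t v) := by
        simpa using (LinearMap.congr_fun hc.eq v).symm
    _ = _ := by rw [hv t, map_smul]

/-- Under `HasSenOperator`, `𝔪_x V_{ℂ_p}` is `Θ`-stable. [cite: BoxerCalegariGeePilloni2025, §4.12 Rem. 4.12.6] -/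
theorem HasSenOperator.sen_mem_maximalIdealImage {D : OrdinaryHigherHidaGSp4 p S Λ 𝕋}
    (h : D.HasSenOperator) (x : 𝕋 →+* PadicAlgCl p) {v : D.VC} (hv : v ∈ D.maximalIdealImage x) :
    D.sen v ∈ D.maximalIdealImage x := by
  unfold maximalIdealImage at hv ⊢
  induction hv using Submodule.iSup_induction' with
  | mem t w hw =>
    obtain ⟨u, rfl⟩ := LinearMap.mem_range.1 hw
    refine Submodule.mem_iSup_of_mem t (LinearMap.mem_range.2 ⟨D.sen u, ?_⟩)
    have hc := LinearMap.congr_fun (h.1 t).eq u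
    simp only [Module.End.mul_apply] at hc
    simp only [LinearMap.sub_apply, LinearMap.smul_apply, LinearMap.id_apply, map_sub, map_smul, hc]
  | zero => simp
  | add v w _ _ hv hw => simpa [map_add] using Submodule.add_mem _ hv hw

/-! ### The zero datum (non-vacuity of the type) -/

/-- **The zero datum** over any coefficient ring `Λ` with a weight-two specialisation, with
`𝕋 = Λ`: all modules zero, all maps zero, trivial Galois representations, no classical points.  It
inhabits the type (so no bare existence statement about `OrdinaryHigherHidaGSp4` carries content —
the reason none is minted here) and satisfies the module-theoretic properties vacuously. [folklore] -/
def trivial (p : ℕ) [Fact p.Prime] (S : Set (HeightOneSpectrum (𝓞 ℚ))) (Λ : Type) [CommRing Λ]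
    [Algebra Λ (PadicAlgCl p)] : OrdinaryHigherHidaGSp4 p S Λ Λ where
  heckeT := fun _ _ => 0
  heckeU := fun _ => 0
  M := fun _ => ModuleCat.of Λ PUnit
  H := fun _ => ModuleCat.of (PadicAlgCl p) PUnit
  heckeH := fun _ => (algebraMap (PadicAlgCl p) _).comp (algebraMap Λ (PadicAlgCl p))
  hidaToColeman := fun _ => 0
  cousinLow := 0
  cousinHigh := 0
  V := ModuleCat.of (PadicAlgCl p) PUnit
  heckeV := (algebraMap (PadicAlgCl p) _).comp (algebraMap Λ (PadicAlgCl p))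
  fil := fun _ => ⊥
  sen := 0
  gradedToColeman := fun _ => 0
  galoisRep := fun _ => 1
  classicalPt := ∅

/-- The type of data is inhabited (by the zero datum). [folklore] -/
instance : Nonempty (OrdinaryHigherHidaGSp4 p S Λ Λ) := ⟨trivial p S Λ⟩

/-- The weight-two points of the zero datum over `Λ` are exactly the structure map (`𝕋 = Λ`).
[folklore] -/
theorem trivial_isWeightTwoPoint_iff (x : Λ →+* PadicAlgCl p) :
    (trivial p S Λ).IsWeightTwoPoint x ↔ x = algebraMap Λ (PadicAlgCl p) := by
  simp [IsWeightTwoPoint]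

/-- The zero datum has no classical points, so `ClassicalPointsAutomorphic` holds for it vacuously
(automorphy properties are NOT consequences of the type). [folklore] -/
theorem trivial_classicalPointsAutomorphic (hcpt : isCompact_glFiniteIntegralLevel 4 ℚ)
    (ι : PadicAlgCl p ≃+* ℂ) : (trivial p S Λ).ClassicalPointsAutomorphic hcpt ι :=
  fun _ hx => (Set.notMem_empty _ hx).elim

end OrdinaryHigherHidaGSp4

end Literature.NumberTheory.Automorphic

end
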